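import Summits.Ventures.HodgeRepro2.T5SU11SphericalSolutionSpace

/-!
# Reduction of order for the radial equation of `SU(1,1)`: from one positive solution to the whole solution space

Row 442 (`T5SU11SphericalSolutionSpace`) spanned the solution space of the radial equation
`sinh 2t · u″ + 2 cosh 2t · u′ = μ sinh 2t · u` on `(0, ∞)` at `μ = (2n+2)(2n)` by the two EXPLICIT solutions
`φ_{2n+2}(a_t)` and `Q_n(cosh 2t)`. This file does the same for EVERY `μ ∈ ℝ` from ONE positive solution `φ` by
d'Alembert's reduction of order: with

  `g(s) = 1/(sinh 2s · φ(s)²)`,  `I(t) = ∫_1^t g(s) ds`,  **`v(t) = φ(t) · I(t)`**  (`roIntegrand`, `roIntegral`,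
  `secondSolution`),

the fundamental theorem of calculus gives `I′ = g` on `(0, ∞)` (`hasDerivAt_roIntegral`; `g` is continuous there),
hence `v′ = φ′ I + 1/(sinh 2t · φ)` and `v″ = φ″ I + φ′ g − (2 cosh 2t · φ + sinh 2t · φ′)/(sinh 2t · φ)²`
(`hasDerivAt_secondSolution`, `hasDerivAt_secondSolution'`), so that

* **`v` solves the radial equation** (`secondSolution_ode`): the `I`-terms reproduce the equation of `φ`, the
  remaining terms cancel identically;
* **`sinh 2t · (φ v′ − φ′ v) = 1`** (`wronskian_secondSolution`): the two solutions are independent;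
* **every solution `u` on `(0, ∞)` is `u = a φ + b v`** with the EXPLICIT constants `a = u(1)/φ(1)` and
  `b = sinh 2 · (φ(1) u′(1) − φ′(1) u(1))` (`eq_add_of_ode`, `exists_eq_add_of_ode`) — row 442's Abel identity
  `sinh 2t · W(u₁, u₂) = const` and the algebraic identity `u · W(φ, v) = W(u, v) φ + W(φ, u) v`;
* consequently a solution is determined by its value and derivative at `t = 1` (`eq_of_ode_of_eq_one`), a solution
  vanishing to first order at `t = 1` vanishes on `(0, ∞)` (`eq_zero_of_ode_of_eq_zero`), and `v > 0` on `(1, ∞)`,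
  `v < 0` on `(0, 1)` (`secondSolution_pos`, `secondSolution_neg`).

Nothing is claimed about (N).

Blind lane: Mathlib + the HodgeRepro2 prefix only; no sorry; axioms ⊆ {propext, Classical.choice,
Quot.sound}.
-/

namespace Summit.Ventures.HodgeRepro2.T5SU11ReductionOfOrder

open Filter Topology MeasureTheory intervalIntegral
open Set (Ioi Ioo uIcc)
open T5SU11SphericalLegendreHigher T5SU11SphericalSolutionSpace

/-! ### The reduction-of-order integral and the second solution -/

/-- The integrand of the reduction-of-order integral, `g(s) = 1/(sinh 2s · φ(s)²)`. -/
noncomputable def roIntegrand (φ : ℝ → ℝ) (s : ℝ) : ℝ := 1 / (Real.sinh (2 * s) * φ s ^ 2)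

/-- The reduction-of-order integral `I(t) = ∫_1^t ds/(sinh 2s · φ(s)²)`. -/
noncomputable def roIntegral (φ : ℝ → ℝ) (t : ℝ) : ℝ := ∫ s in (1 : ℝ)..t, roIntegrand φ s

/-- **The second solution** `v(t) = φ(t) · ∫_1^t ds/(sinh 2s · φ(s)²)`. -/
noncomputable def secondSolution (φ : ℝ → ℝ) (t : ℝ) : ℝ := φ t * roIntegral φ t

/-- `v′(t) = φ′(t) · I(t) + 1/(sinh 2t · φ(t))`. -/
noncomputable def secondSolution' (φ φ' : ℝ → ℝ) (t : ℝ) : ℝ :=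
  φ' t * roIntegral φ t + (Real.sinh (2 * t) * φ t)⁻¹

/-- `v″(t) = φ″(t) · I(t) + φ′(t) · g(t) − (2 cosh 2t · φ(t) + sinh 2t · φ′(t))/(sinh 2t · φ(t))²`. -/
noncomputable def secondSolution'' (φ φ' φ'' : ℝ → ℝ) (t : ℝ) : ℝ :=
  φ'' t * roIntegral φ t + φ' t * roIntegrand φ t
    - (2 * Real.cosh (2 * t) * φ t + Real.sinh (2 * t) * φ' t) / (Real.sinh (2 * t) * φ t) ^ 2

/-- `sinh 2t > 0` for `t > 0`. -/
theorem sinh_two_mul_pos {t : ℝ} (ht : 0 < t) : 0 < Real.sinh (2 * t) :=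
  Real.sinh_pos_iff.mpr (by linarith)

/-- `I(1) = 0`. -/
theorem roIntegral_one (φ : ℝ → ℝ) : roIntegral φ 1 = 0 := by
  unfold roIntegral
  exact integral_same

/-- `v(1) = 0`. -/
theorem secondSolution_one (φ : ℝ → ℝ) : secondSolution φ 1 = 0 := by
  unfold secondSolution
  rw [roIntegral_one, mul_zero]

/-- `v′(1) = 1/(sinh 2 · φ(1))`. -/
theorem secondSolution'_one (φ φ' : ℝ → ℝ) : secondSolution' φ φ' 1 = (Real.sinh (2 * 1) * φ 1)⁻¹ := by
  unfold secondSolution'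
  rw [roIntegral_one, mul_zero, zero_add]

section

variable {μ : ℝ} {φ φ' φ'' : ℝ → ℝ}
  (hφ : ∀ t, 0 < t → HasDerivAt φ (φ' t) t) (hφ' : ∀ t, 0 < t → HasDerivAt φ' (φ'' t) t)
  (hpos : ∀ t, 0 < t → 0 < φ t)

/-! ### Continuity of the integrand and the fundamental theorem of calculus -/

include hφ hpos in
/-- `g` is continuous on `(0, ∞)`. -/
theorem continuousOn_roIntegrand : ContinuousOn (roIntegrand φ) (Ioi 0) := by
  intro s hs
  have hs' : 0 < s := hs
  have hden : Real.sinh (2 * s) * φ s ^ 2 ≠ 0 :=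
    (mul_pos (sinh_two_mul_pos hs') (pow_pos (hpos s hs') 2)).ne'
  have h1 : ContinuousAt (fun s => Real.sinh (2 * s) * φ s ^ 2) s :=
    ((Real.continuous_sinh.comp (continuous_const.mul continuous_id)).continuousAt).mul
      ((hφ s hs').continuousAt.pow 2)
  show ContinuousWithinAt (fun s => 1 / (Real.sinh (2 * s) * φ s ^ 2)) (Ioi 0) s
  exact (continuousAt_const.div₀ h1 hden).continuousWithinAt

include hφ hpos in
/-- `[[1, t]] ⊆ (0, ∞)` for `t > 0`, so `g` is interval integrable on `1..t`. -/
theorem intervalIntegrable_roIntegrand {t : ℝ} (ht : 0 < t) :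
    IntervalIntegrable (roIntegrand φ) volume 1 t := by
  refine ((continuousOn_roIntegrand hφ hpos).mono ?_).intervalIntegrable
  intro x hx
  rcases Set.mem_uIcc.mp hx with ⟨h1, _⟩ | ⟨h1, _⟩
  · exact lt_of_lt_of_le one_pos h1
  · exact lt_of_lt_of_le ht h1

include hφ hpos in
/-- **`I′(t) = g(t)`** on `(0, ∞)`. -/
theorem hasDerivAt_roIntegral {t : ℝ} (ht : 0 < t) : HasDerivAt (roIntegral φ) (roIntegrand φ t) t := by
  have hcont := continuousOn_roIntegrand hφ hpos
  show HasDerivAt (fun u => ∫ s in (1 : ℝ)..u, roIntegrand φ s) _ t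
  exact integral_hasDerivAt_right (intervalIntegrable_roIntegrand hφ hpos ht)
    (hcont.stronglyMeasurableAtFilter isOpen_Ioi t ht) (hcont.continuousAt (isOpen_Ioi.mem_nhds ht))

/-! ### The derivatives of the second solution -/

include hφ hpos in
/-- **`v′ = φ′ I + 1/(sinh 2t · φ)`** on `(0, ∞)`. -/
theorem hasDerivAt_secondSolution {t : ℝ} (ht : 0 < t) :
    HasDerivAt (secondSolution φ) (secondSolution' φ φ' t) t := by
  have h := (hφ t ht).mul (hasDerivAt_roIntegral hφ hpos ht)
  have hS : Real.sinh (2 * t) ≠ 0 := (sinh_two_mul_pos ht).ne'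
  have hφt : φ t ≠ 0 := (hpos t ht).ne'
  show HasDerivAt (fun t => φ t * roIntegral φ t) _ t
  refine h.congr_deriv ?_
  unfold secondSolution' roIntegrand
  field_simp

include hφ hφ' hpos in
/-- **`v″ = φ″ I + φ′ g − (2 cosh 2t · φ + sinh 2t · φ′)/(sinh 2t · φ)²`** on `(0, ∞)`. -/
theorem hasDerivAt_secondSolution' {t : ℝ} (ht : 0 < t) :
    HasDerivAt (secondSolution' φ φ') (secondSolution'' φ φ' φ'' t) t := by
  have hden : Real.sinh (2 * t) * φ t ≠ 0 := mul_ne_zero (sinh_two_mul_pos ht).ne' (hpos t ht).ne'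
  have h1 := (hφ' t ht).mul (hasDerivAt_roIntegral hφ hpos ht)
  have h2 := ((hasDerivAt_sinh_two_mul_self t).mul (hφ t ht)).inv hden
  have h := h1.add h2
  show HasDerivAt (fun t => φ' t * roIntegral φ t + (Real.sinh (2 * t) * φ t)⁻¹) _ t
  refine h.congr_deriv ?_
  simp only [Pi.mul_apply]
  unfold secondSolution''
  ring

/-! ### The second solution solves the equation; the Wronskian -/

include hpos in
/-- **`v` solves the radial equation** `sinh 2t · v″ + 2 cosh 2t · v′ = μ sinh 2t · v` on `(0, ∞)` (a pure
identity once the derivative data are in place: the `I`-terms carry the equation of `φ`, the rest cancels). -/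
theorem secondSolution_ode
    (hode : ∀ t, 0 < t → Real.sinh (2 * t) * φ'' t + 2 * Real.cosh (2 * t) * φ' t = μ * Real.sinh (2 * t) * φ t)
    {t : ℝ} (ht : 0 < t) :
    Real.sinh (2 * t) * secondSolution'' φ φ' φ'' t + 2 * Real.cosh (2 * t) * secondSolution' φ φ' t
      = μ * Real.sinh (2 * t) * secondSolution φ t := by
  have hS : Real.sinh (2 * t) ≠ 0 := (sinh_two_mul_pos ht).ne'
  have hφt : φ t ≠ 0 := (hpos t ht).ne'
  have hden : Real.sinh (2 * t) * φ t ≠ 0 := mul_ne_zero hS hφt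
  have hg : roIntegrand φ t = Real.sinh (2 * t) * ((Real.sinh (2 * t) * φ t)⁻¹) ^ 2 := by
    unfold roIntegrand
    field_simp
  have hq : (Real.sinh (2 * t) * φ t)⁻¹ * (Real.sinh (2 * t) * φ t) = 1 := inv_mul_cancel₀ hden
  have e := hode t ht
  unfold secondSolution'' secondSolution' secondSolution
  linear_combination (roIntegral φ t) * e - (2 * Real.cosh (2 * t) * (Real.sinh (2 * t) * φ t)⁻¹) * hq
    + (Real.sinh (2 * t) * φ' t) * hg

include hpos in
/-- **The Wronskian**: `sinh 2t · (φ v′ − φ′ v) = 1` on `(0, ∞)`. -/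
theorem wronskian_secondSolution {t : ℝ} (ht : 0 < t) :
    Real.sinh (2 * t) * (φ t * secondSolution' φ φ' t - φ' t * secondSolution φ t) = 1 := by
  have hden : Real.sinh (2 * t) * φ t ≠ 0 := mul_ne_zero (sinh_two_mul_pos ht).ne' (hpos t ht).ne'
  unfold secondSolution' secondSolution
  have e : Real.sinh (2 * t) * (φ t * (φ' t * roIntegral φ t + (Real.sinh (2 * t) * φ t)⁻¹)
      - φ' t * (φ t * roIntegral φ t)) = (Real.sinh (2 * t) * φ t) * (Real.sinh (2 * t) * φ t)⁻¹ := by ring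
  rw [e, mul_inv_cancel₀ hden]

/-! ### The solution space -/

include hφ hφ' hpos in
/-- **THE SOLUTION SPACE, with explicit constants**: every solution `u` of `sinh 2t · u″ + 2 cosh 2t · u′ =
μ sinh 2t · u` on `(0, ∞)` equals `(u(1)/φ(1)) · φ + sinh 2 · (φ(1) u′(1) − φ′(1) u(1)) · v` there. -/
theorem eq_add_of_ode
    (hode : ∀ t, 0 < t → Real.sinh (2 * t) * φ'' t + 2 * Real.cosh (2 * t) * φ' t = μ * Real.sinh (2 * t) * φ t)
    {u u' u'' : ℝ → ℝ} (hu : ∀ t, 0 < t → HasDerivAt u (u' t) t) (hu' : ∀ t, 0 < t → HasDerivAt u' (u'' t) t)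
    (huode : ∀ t, 0 < t → Real.sinh (2 * t) * u'' t + 2 * Real.cosh (2 * t) * u' t = μ * Real.sinh (2 * t) * u t)
    {t : ℝ} (ht : 0 < t) :
    u t = (u 1 / φ 1) * φ t + (Real.sinh 2 * (φ 1 * u' 1 - φ' 1 * u 1)) * secondSolution φ t := by
  -- the second solution with its derivative data
  have hvd : ∀ t, 0 < t → HasDerivAt (secondSolution φ) (secondSolution' φ φ' t) t :=
    fun t ht => hasDerivAt_secondSolution hφ hpos ht
  have hvd' : ∀ t, 0 < t → HasDerivAt (secondSolution' φ φ') (secondSolution'' φ φ' φ'' t) t :=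
    fun t ht => hasDerivAt_secondSolution' hφ hφ' hpos ht
  have hvode : ∀ t, 0 < t → Real.sinh (2 * t) * secondSolution'' φ φ' φ'' t
      + 2 * Real.cosh (2 * t) * secondSolution' φ φ' t = μ * Real.sinh (2 * t) * secondSolution φ t :=
    fun t ht => secondSolution_ode hpos hode ht
  have hS2 : Real.sinh (2 * 1) ≠ 0 := (sinh_two_mul_pos one_pos).ne'
  have hφ1 : φ 1 ≠ 0 := (hpos 1 one_pos).ne'
  -- the three Wronskians at `t`, by Abel's identity evaluated at `t = 1`
  have hW_φv : Real.sinh (2 * t) * (φ t * secondSolution' φ φ' t - φ' t * secondSolution φ t) = 1 :=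
    wronskian_secondSolution hpos ht
  have hW_uv : Real.sinh (2 * t) * (u t * secondSolution' φ φ' t - u' t * secondSolution φ t) = u 1 / φ 1 := by
    rw [sinh_mul_wronskian_const hu hu' huode hvd hvd' hvode ht one_pos, secondSolution_one,
      secondSolution'_one]
    field_simp
    ring
  have hW_φu : Real.sinh (2 * t) * (φ t * u' t - φ' t * u t) = Real.sinh 2 * (φ 1 * u' 1 - φ' 1 * u 1) := by
    rw [sinh_mul_wronskian_const hφ hφ' hode hu hu' huode ht one_pos]
    norm_num
  -- the algebraic identity `u · W(φ, v) = W(u, v) · φ + W(φ, u) · v`, multiplied by `sinh 2t`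
  have key := wronskian_identity (u t) (u' t) (φ t) (φ' t) (secondSolution φ t) (secondSolution' φ φ' t)
  have e : Real.sinh (2 * t) * (u t * (φ t * secondSolution' φ φ' t - φ' t * secondSolution φ t))
      = Real.sinh (2 * t) * ((u t * secondSolution' φ φ' t - u' t * secondSolution φ t) * φ t
        + (φ t * u' t - φ' t * u t) * secondSolution φ t) := by
    rw [key]
  linear_combination (-(u t)) * hW_φv + e + (φ t) * hW_uv + (secondSolution φ t) * hW_φu

include hφ hφ' hpos in
/-- **THE SOLUTION SPACE IS TWO-DIMENSIONAL**: every solution on `(0, ∞)` is `a φ + b v` with constants `a, b`. -/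
theorem exists_eq_add_of_ode
    (hode : ∀ t, 0 < t → Real.sinh (2 * t) * φ'' t + 2 * Real.cosh (2 * t) * φ' t = μ * Real.sinh (2 * t) * φ t)
    {u u' u'' : ℝ → ℝ} (hu : ∀ t, 0 < t → HasDerivAt u (u' t) t) (hu' : ∀ t, 0 < t → HasDerivAt u' (u'' t) t)
    (huode : ∀ t, 0 < t → Real.sinh (2 * t) * u'' t + 2 * Real.cosh (2 * t) * u' t = μ * Real.sinh (2 * t) * u t) :
    ∃ a b : ℝ, ∀ t, 0 < t → u t = a * φ t + b * secondSolution φ t :=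
  ⟨u 1 / φ 1, Real.sinh 2 * (φ 1 * u' 1 - φ' 1 * u 1), fun _ ht => eq_add_of_ode hφ hφ' hpos hode hu hu' huode ht⟩

include hφ hφ' hpos in
/-- **Uniqueness**: two solutions with the same value and derivative at `t = 1` agree on `(0, ∞)`. -/
theorem eq_of_ode_of_eq_one
    (hode : ∀ t, 0 < t → Real.sinh (2 * t) * φ'' t + 2 * Real.cosh (2 * t) * φ' t = μ * Real.sinh (2 * t) * φ t)
    {u u' u'' w w' w'' : ℝ → ℝ}
    (hu : ∀ t, 0 < t → HasDerivAt u (u' t) t) (hu' : ∀ t, 0 < t → HasDerivAt u' (u'' t) t)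
    (huode : ∀ t, 0 < t → Real.sinh (2 * t) * u'' t + 2 * Real.cosh (2 * t) * u' t = μ * Real.sinh (2 * t) * u t)
    (hw : ∀ t, 0 < t → HasDerivAt w (w' t) t) (hw' : ∀ t, 0 < t → HasDerivAt w' (w'' t) t)
    (hwode : ∀ t, 0 < t → Real.sinh (2 * t) * w'' t + 2 * Real.cosh (2 * t) * w' t = μ * Real.sinh (2 * t) * w t)
    (h0 : u 1 = w 1) (h1 : u' 1 = w' 1) {t : ℝ} (ht : 0 < t) : u t = w t := by
  rw [eq_add_of_ode hφ hφ' hpos hode hu hu' huode ht, eq_add_of_ode hφ hφ' hpos hode hw hw' hwode ht, h0, h1]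

include hφ hφ' hpos in
/-- A solution vanishing to first order at `t = 1` vanishes on `(0, ∞)`. -/
theorem eq_zero_of_ode_of_eq_zero
    (hode : ∀ t, 0 < t → Real.sinh (2 * t) * φ'' t + 2 * Real.cosh (2 * t) * φ' t = μ * Real.sinh (2 * t) * φ t)
    {u u' u'' : ℝ → ℝ} (hu : ∀ t, 0 < t → HasDerivAt u (u' t) t) (hu' : ∀ t, 0 < t → HasDerivAt u' (u'' t) t)
    (huode : ∀ t, 0 < t → Real.sinh (2 * t) * u'' t + 2 * Real.cosh (2 * t) * u' t = μ * Real.sinh (2 * t) * u t)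
    (h0 : u 1 = 0) (h1 : u' 1 = 0) {t : ℝ} (ht : 0 < t) : u t = 0 := by
  rw [eq_add_of_ode hφ hφ' hpos hode hu hu' huode ht, h0, h1]
  ring

/-! ### The sign of the second solution -/

include hφ hpos in
/-- `I(t) > 0` for `t > 1`. -/
theorem roIntegral_pos {t : ℝ} (ht : 1 < t) : 0 < roIntegral φ t := by
  refine intervalIntegral_pos_of_pos_on (intervalIntegrable_roIntegrand hφ hpos (by linarith)) ?_ ht
  intro x hx
  have hx0 : 0 < x := by linarith [hx.1]
  unfold roIntegrand
  exact div_pos one_pos (mul_pos (sinh_two_mul_pos hx0) (pow_pos (hpos x hx0) 2))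

include hφ hpos in
/-- `I(t) < 0` for `0 < t < 1`. -/
theorem roIntegral_neg {t : ℝ} (ht0 : 0 < t) (ht : t < 1) : roIntegral φ t < 0 := by
  have h : 0 < ∫ s in t..(1 : ℝ), roIntegrand φ s := by
    refine intervalIntegral_pos_of_pos_on (intervalIntegrable_roIntegrand hφ hpos ht0).symm ?_ ht
    intro x hx
    have hx0 : 0 < x := by linarith [hx.1]
    unfold roIntegrand
    exact div_pos one_pos (mul_pos (sinh_two_mul_pos hx0) (pow_pos (hpos x hx0) 2))
  unfold roIntegral
  rw [integral_symm] at h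
  linarith

include hφ hpos in
/-- **`v > 0` on `(1, ∞)`.** -/
theorem secondSolution_pos {t : ℝ} (ht : 1 < t) : 0 < secondSolution φ t :=
  mul_pos (hpos t (by linarith)) (roIntegral_pos hφ hpos ht)

include hφ hpos in
/-- **`v < 0` on `(0, 1)`.** -/
theorem secondSolution_neg {t : ℝ} (ht0 : 0 < t) (ht : t < 1) : secondSolution φ t < 0 :=
  mul_neg_of_pos_of_neg (hpos t ht0) (roIntegral_neg hφ hpos ht0 ht)

end

end Summit.Ventures.HodgeRepro2.T5SU11ReductionOfOrder
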